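import Mathlib

/-!
# Manin–Gamma cell (pub-manin-gamma0): the 2-descent algebra of Appendix A, machine-checked (seat p1; lead's target L-AppA)

`proofs/AppA_descent_lead.md` derives the descent dictionary (D1)–(D4) from explicit identities on
`E : y² = (x−e₁)(x−e₂)(x−e₃)`, written in translated coordinates `y² = x³ + a x² + b x` (`e_i ↦ 0`,
`a = −(e_j + e_k)`, `b = e_j e_k`, `T_i = (0,0)`, `T_j = (e_j,0)`), with `r(Q) := (x₀² − b)/(2y₀)` for `Q = (x₀, y₀)`:
* **A1** `x(2Q) = r(Q)²` where `x(2Q) = λ² − a − 2x₀`, `λ = (3x₀² + 2a x₀ + b)/(2y₀)` (tangent);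
* **A2** `r(Q + T_i) = r(Q)`, `r(Q + T_j) = −r(Q)`, where by the chord construction `Q + T_i = (b/x₀, −b y₀/x₀²)`,
  `Q + T_j = (x₁, y₁)`, `x₁ = e_j(x₀ − e_k)/(x₀ − e_j)`, `y₁ = −y₀ e_j (e_j − e_k)/(x₀ − e_j)²`.
The only elliptic-curve input is the chord–tangent law [Silverman AEC III.2.3]: the abscissae of the three
intersections of a line with the cubic are the three roots of a monic cubic whose `x²`-coefficient is known,
and `P + Q + R = O` for collinear `P, Q, R`, `−(x,y) = (x, −y − a₁x − a₃)` (here `a₁ = a₃ = 0`).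
Everything else is field algebra, verified below over an arbitrary field `K` (with `2 ≠ 0` where `2y₀` is inverted):
`third_root` (Vieta for the chord through a 2-torsion point), `chord_Ti_x`, `chord_Tj_x`, `chord_Tj_y`
(the abscissa/ordinate formulas), `duplication` (A1), `sign_rule_Ti`, `sign_rule_Tj` (A2), and the
polynomial identity `dup_poly_identity` behind A1.
-/

namespace ManinGamma.Descent

variable {K : Type*} [Field K]

/-- A1 as a polynomial identity (no division): `(3x² + 2ax + b)² − 4(x³ + ax² + bx)(a + 2x) = (x² − b)²`. -/
theorem dup_poly_identity (x a b : K) :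
    (3 * x ^ 2 + 2 * a * x + b) ^ 2 - 4 * (x ^ 3 + a * x ^ 2 + b * x) * (a + 2 * x) = (x ^ 2 - b) ^ 2 := by
  ring

/-- **A1 (duplication).** On `y² = x³ + ax² + bx`, for `Q = (x₀,y₀)` with `y₀ ≠ 0` and `2 ≠ 0` in `K`:
`λ² − a − 2x₀ = ((x₀² − b)/(2y₀))²` with `λ = (3x₀² + 2ax₀ + b)/(2y₀)`; i.e. `x(2Q) = r(Q)²`. -/
theorem duplication (x₀ y₀ a b : K) (h2 : (2 : K) ≠ 0) (hy : y₀ ≠ 0)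
    (hE : y₀ ^ 2 = x₀ ^ 3 + a * x₀ ^ 2 + b * x₀) :
    ((3 * x₀ ^ 2 + 2 * a * x₀ + b) / (2 * y₀)) ^ 2 - a - 2 * x₀ = ((x₀ ^ 2 - b) / (2 * y₀)) ^ 2 := by
  have h2y : 2 * y₀ ≠ 0 := mul_ne_zero h2 hy
  rw [div_pow, div_pow, sub_sub, eq_div_iff (pow_ne_zero 2 h2y), sub_mul, div_mul_cancel₀ _ (pow_ne_zero 2 h2y)]
  linear_combination (-(4 : K)) * (a + 2 * x₀) * hE

/-- **Vieta for a chord through a point of the `x`-axis.** Let `P(x) = x³ + a x² + b x − μ²(x − t)²` (the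
intersection polynomial of the line `y = μ(x − t)` with `y² = x³ + ax² + bx`). If `t` and `x₀ ≠ t` are roots of `P`,
then so is `x₁ := μ² − a − t − x₀` (the three roots sum to minus the `x²`-coefficient `a − μ²`). -/
theorem third_root (a b μ t x₀ : K) (hne : x₀ ≠ t)
    (ht : t ^ 3 + a * t ^ 2 + b * t - μ ^ 2 * (t - t) ^ 2 = 0)
    (hx : x₀ ^ 3 + a * x₀ ^ 2 + b * x₀ - μ ^ 2 * (x₀ - t) ^ 2 = 0) :
    (μ ^ 2 - a - t - x₀) ^ 3 + a * (μ ^ 2 - a - t - x₀) ^ 2 + b * (μ ^ 2 - a - t - x₀)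
      - μ ^ 2 * ((μ ^ 2 - a - t - x₀) - t) ^ 2 = 0 := by
  set x₁ := μ ^ 2 - a - t - x₀ with hx₁
  -- P(x) − (x−t)(x−x₀)(x−x₁) is LINEAR in x (the cubic and quadratic terms cancel by the choice of x₁):
  set c₁ := (b + 2 * μ ^ 2 * t) - (t * x₀ + t * x₁ + x₀ * x₁) with hc₁
  set c₀ := -μ ^ 2 * t ^ 2 + t * x₀ * x₁ with hc₀
  have hL : ∀ x : K, x ^ 3 + a * x ^ 2 + b * x - μ ^ 2 * (x - t) ^ 2 - (x - t) * (x - x₀) * (x - x₁)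
      = c₁ * x + c₀ := by
    intro x; rw [hc₁, hc₀, hx₁]; ring
  have h1 : c₁ * t + c₀ = 0 := by have := hL t; rw [← this]; rw [ht]; ring
  have h2 : c₁ * x₀ + c₀ = 0 := by have := hL x₀; rw [← this]; rw [hx]; ring
  have hc1 : c₁ = 0 := by
    have : c₁ * (x₀ - t) = 0 := by linear_combination h2 - h1
    rcases mul_eq_zero.mp this with h | h
    · exact h
    · exact absurd (sub_eq_zero.mp h) hne
  have hc0 : c₀ = 0 := by rw [hc1] at h1; simpa using h1
  have := hL x₁
  rw [hc1, hc0] at this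
  linear_combination this

/-- Chord through `T_i = (0,0)`: on `y² = x³ + ax² + bx` with `x₀ ≠ 0`, the slope is `μ = y₀/x₀` and the third
abscissa `μ² − a − 0 − x₀` equals `b/x₀`. (So `Q + T_i = (b/x₀, −b y₀/x₀²)` after negating `y = μ x`.) -/
theorem chord_Ti_x (x₀ y₀ a b : K) (hx : x₀ ≠ 0) (hE : y₀ ^ 2 = x₀ ^ 3 + a * x₀ ^ 2 + b * x₀) :
    (y₀ / x₀) ^ 2 - a - 0 - x₀ = b / x₀ := by
  rw [div_pow, sub_zero]
  field_simp
  linear_combination hE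

/-- The ordinate at the third point for the chord through `T_i`: `μ · (b/x₀) = b y₀/x₀²` with `μ = y₀/x₀`. -/
theorem chord_Ti_y (x₀ y₀ b : K) : (y₀ / x₀) * (b / x₀) = b * y₀ / x₀ ^ 2 := by
  rw [div_mul_div_comm, mul_comm y₀ b, pow_two]

/-- Chord through `T_j = (e_j, 0)` on `y² = x(x − e_j)(x − e_k)` (so `a = −(e_j + e_k)`): for `x₀ ≠ e_j` the third
abscissa `μ² − a − e_j − x₀` with `μ = y₀/(x₀ − e_j)` equals `x₁ = e_j(x₀ − e_k)/(x₀ − e_j)`. -/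
theorem chord_Tj_x (x₀ y₀ ej ek : K) (hx : x₀ ≠ ej)
    (hE : y₀ ^ 2 = x₀ * (x₀ - ej) * (x₀ - ek)) :
    (y₀ / (x₀ - ej)) ^ 2 - (-(ej + ek)) - ej - x₀ = ej * (x₀ - ek) / (x₀ - ej) := by
  have hsub : x₀ - ej ≠ 0 := sub_ne_zero.mpr hx
  rw [div_pow]
  field_simp
  linear_combination hE

/-- The ordinate at the third point for the chord through `T_j`: `μ(x₁ − e_j) = y₀ e_j(e_j − e_k)/(x₀ − e_j)²`,
so `Q + T_j = (x₁, −y₀ e_j (e_j − e_k)/(x₀ − e_j)²)`. -/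
theorem chord_Tj_y (x₀ y₀ ej ek : K) (hx : x₀ ≠ ej) :
    (y₀ / (x₀ - ej)) * (ej * (x₀ - ek) / (x₀ - ej) - ej) = y₀ * ej * (ej - ek) / (x₀ - ej) ^ 2 := by
  have hsub : x₀ - ej ≠ 0 := sub_ne_zero.mpr hx
  field_simp
  ring

/-- **A2, case `T_i`:** `r(Q + T_i) = r(Q)`, i.e. `((b/x₀)² − b)/(2·(−b y₀/x₀²)) = (x₀² − b)/(2y₀)`
(needs `x₀, y₀, b ≠ 0` and `2 ≠ 0`). -/
theorem sign_rule_Ti (x₀ y₀ b : K) (h2 : (2 : K) ≠ 0) (hx : x₀ ≠ 0) (hy : y₀ ≠ 0) (hb : b ≠ 0) :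
    ((b / x₀) ^ 2 - b) / (2 * (-(b * y₀ / x₀ ^ 2))) = (x₀ ^ 2 - b) / (2 * y₀) := by
  field_simp
  ring

/-- **A2, case `T_j` (`j ≠ i`):** with `b = e_j e_k`, `x₁ = e_j(x₀ − e_k)/(x₀ − e_j)`, `y₁ = −y₀ e_j(e_j − e_k)/(x₀ − e_j)²`:
`r(Q + T_j) = (x₁² − b)/(2y₁) = −(x₀² − b)/(2y₀)` (needs `x₀ ≠ e_j`, `y₀ ≠ 0`, `e_j ≠ 0`, `e_j ≠ e_k`, `2 ≠ 0`). -/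
theorem sign_rule_Tj (x₀ y₀ ej ek : K) (h2 : (2 : K) ≠ 0) (hx : x₀ ≠ ej) (hy : y₀ ≠ 0) (hej : ej ≠ 0)
    (hjk : ej ≠ ek) :
    ((ej * (x₀ - ek) / (x₀ - ej)) ^ 2 - ej * ek) / (2 * (-(y₀ * ej * (ej - ek) / (x₀ - ej) ^ 2)))
      = -((x₀ ^ 2 - ej * ek) / (2 * y₀)) := by
  have hsub : x₀ - ej ≠ 0 := sub_ne_zero.mpr hx
  have hjk' : ej - ek ≠ 0 := sub_ne_zero.mpr hjk
  field_simp
  ring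

/-- The sub-identity used in AppA A2 (`T_j` case): `e_j²(x₀ − e_k)² − e_j e_k (x₀ − e_j)² = e_j (e_j − e_k)(x₀² − e_j e_k)`. -/
theorem sign_rule_Tj_numerator (x₀ ej ek : K) :
    ej ^ 2 * (x₀ - ek) ^ 2 - ej * ek * (x₀ - ej) ^ 2 = ej * (ej - ek) * (x₀ ^ 2 - ej * ek) := by
  ring

end ManinGamma.Descent
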